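import Literature.AnabelianGeometry.AbsoluteAnabelian.AbsTopII.DatumOpenImmersionKernelLaw
import Literature.AnabelianGeometry.AbsoluteAnabelian.AbsTopII.BelyiCuspidalizationDatumKernelLaw
import HarnessLib

/-!
# [AbsTopII] Cor 3.7″ / Cor 3.8 inside a datum UNDER THE TYPED KERNEL LAW
# (`EllipticDatumModel.OpenImmersionKernelLaw`, abc-iut-L4-t6 p444018): bridges both ways

S. Mochizuki, *Topics in Absolute Anabelian Geometry II* [AbsTopII] (bib `MochizukiAbsTopII2013`;
manuscript pagination, lit key `paper:url-585b8d0ad0d9`): Cor 3.7 pp. 72–73, Cor 3.8 p. 74; [AbsTopI]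
(`MochizukiAbsTopI2012`) Def 4.2 (iii)(c) p. 50 (the kernel of a de-cuspidalization).

PROOF-ONLY companion (no definition / instance / structure), cell abc-iut, seat abc-iut-f-064, row
«COR37-DATUM-CERT» → «OPEN-IMM-KERNEL-LAW» (abc-iut-L4-lead RULING #8h (3); the law located by
`BelyiCuspidalizationDatumSchemaScope.lean` p441764/p442459 was TYPED by abc-iut-L4-t6 as the `Prop`-mixin
`EllipticDatumModel.OpenImmersionKernelLaw` — ONE field `ker_eq`: for every datum open immersion
`ι : U → X` and representative `ψ` of `[π₁(ι)]`, `Ker ψ` is the closed normal closure of `⋃_{c ∈ S} I_c`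
for some set `S` of cusps of `U`).  This file binds that mixin BY NAME and records, in the kernel, what
it does and does not decide for the datum forms `toBelyiModel.Cor_3_7''` / `toBelyiModel.Cor_3_8`
(abc-iut-L4-t6 p439386):

* `BelyiDatumModel.toBelyiModel_cor_3_7''_of_openImmersionKernelLaw_of_isEmpty_cusp`,
  `BelyiDatumModel.toBelyiModel_cor_3_8_of_openImmersionKernelLaw_of_isEmpty_cusp` — UNDER THE TYPED LAW,
  at cusp-free data both datum facts HOLD (bridges onto p442459's hypothesis-shaped deciders: the law
  gives `Ker ψ ≤` the closed normal closure of the `D_c`'s, `I_c ≤ D_c`);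
* `BelyiDatumModel.exists_openImmersionKernelLaw_and_not_toBelyiModel_cor_3_7''_and_not_cor_3_8` — a junk
  DATUM model over the REAL field `ℚ_2` (universe `0`) SATISFYING THE TYPED LAW (baked into the datum's
  Hom-sets: every representative of every `[π₁(f)]`, `f : A → B`, has kernel EQUAL to the closed normal
  closure of `⋃_{c ∈ S} I_c` for some set `S` of cusps recorded on `A`), flags = laws, chain-full,
  rel-isom-DGC, members `X₁ ≅ X₂` cusp-free with `IsCor37Member`, and the open `U → X₁` (`[pr₁]`,
  `Π_U = (G × G) × G`) recording ONE cusp with `D = I = Ker(pr₁) = 1 × 1 × G ⊆ Δ_U` — where nevertheless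
  `¬ toBelyiModel.Cor_3_7''` (kernel form at the cusp-free member `X₁`) and `¬ toBelyiModel.Cor_3_8`;
* `not_forall_toBelyiModel_cor_3_7''_of_openImmersionKernelLaw`,
  `not_forall_toBelyiModel_cor_3_8_of_openImmersionKernelLaw` — so the typed law does NOT close the rows:
  `toBelyiModel.Cor_3_7''` / `Cor_3_8` remain HYPOTHESES on `(𝒟, M)`, bindable per instance (R5); the
  law is a faithfulness gain (it excludes the cusp-free separation model of p441764), count-neutral.

READING (honest framing): statements about OUR typed interfaces; the model is junk no étale `π₁`
supplies (a curve of strictly Belyi type is AFFINE — Def 3.5 — so it records cusps; here `X₁` records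
none, no chain term exists, `Π = G × G`, and the one "cusp" of `U` has `D = I`, i.e. trivial image in `G`);
refuted-as-schema ≠ refuted-in-print; no side taken on [IUTchIII] Cor 3.12; typed ≠ proved.
-/

open CategoryTheory Topology
open scoped Pointwise

universe u

namespace Literature.AnabelianGeometry.AbsoluteAnabelian.AbsTopII

open Literature.AlgebraicGeometry.Frobenioids (IsSlimGroup)
open FundamentalExtension
open AbsTopI (ConstructionDataClass)
open AbsTopIII (IsGeneralizedSubpadicFor IsSubpadicFor cyclotomicChar)
open AugmentedProfiniteGrp

variable {𝒟 : ConstructionDataClass.{u}}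

/-! ## Under the typed law, at cusp-free data both datum facts HOLD -/

namespace BelyiDatumModel

variable (M : BelyiDatumModel 𝒟)

/-- The typed law bounds every datum NF-open's kernel by the closed normal closure of the decomposition
groups of the cusps of `U` (`I_c ≤ D_c`) — the hypothesis shape of p442459's deciders.
[cite: MochizukiAbsTopI2012, Def 4.2 (iii)(c) p.50] -/
theorem NFOpen.ker_le_of_openImmersionKernelLaw (hK : M.toEllipticDatumModel.OpenImmersionKernelLaw)
    {b : 𝒟.Base} {X : (𝒟.datum b).Obj} (O : M.NFOpen b X) :
    (O.ψ.toHom.toMonoidHom.ker : Subgroup ((𝒟.datum b).ext O.U).arith) ≤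
      (Subgroup.normalClosure (⋃ c : (M.cusps b O.U).Cusp,
        ((M.cusps b O.U).Dcusp c : Set ((𝒟.datum b).ext O.U).arith))).topologicalClosure := by
  obtain ⟨S, hS⟩ := hK.ker_eq O.ι O.isOpenImmersion O.ψ O.mk_ψ
  rw [hS]
  refine Subgroup.topologicalClosure_mono (Subgroup.normalClosure_mono ?_)
  intro x hx
  simp only [Set.mem_iUnion] at hx ⊢
  obtain ⟨c, -, hc⟩ := hx
  exact ⟨c, (M.cusps b O.U).Icusp_le_Dcusp c hc⟩

/-- **Under the typed kernel law the datum Cor 3.7 HOLDS at cusp-free data** (every `ψ` injective, the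
identity chain realized; bridge onto p442459 `toBelyiModel_cor_3_7''_of_ker_le_of_isEmpty_cusp`).
[cite: MochizukiAbsTopII2013, Cor 3.7 pp.72-73] -/
theorem toBelyiModel_cor_3_7''_of_openImmersionKernelLaw_of_isEmpty_cusp
    (hK : M.toEllipticDatumModel.OpenImmersionKernelLaw)
    (hE : ∀ (b : 𝒟.Base) (X : (𝒟.datum b).Obj), IsEmpty (M.cusps b X).Cusp) :
    M.toBelyiModel.Cor_3_7'' :=
  M.toBelyiModel_cor_3_7''_of_ker_le_of_isEmpty_cusp
    (fun _ _ O => NFOpen.ker_le_of_openImmersionKernelLaw M hK O) hE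

/-- **Under the typed kernel law the datum Cor 3.8 HOLDS at cusp-free data**, every member having a
datum NF-open (every `ψ` bijective; bridge onto p442459 `toBelyiModel_cor_3_8_of_ker_le_of_isEmpty_cusp`).
[cite: MochizukiAbsTopII2013, Cor 3.8 p.74] -/
theorem toBelyiModel_cor_3_8_of_openImmersionKernelLaw_of_isEmpty_cusp
    (hK : M.toEllipticDatumModel.OpenImmersionKernelLaw)
    (hE : ∀ (b : 𝒟.Base) (X : (𝒟.datum b).Obj), IsEmpty (M.cusps b X).Cusp)
    (hne : ∀ (b : 𝒟.Base) (X : (𝒟.datum b).Obj), M.toBelyiModel.IsCor37Member b X →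
      Nonempty (M.NFOpen b X)) :
    M.toBelyiModel.Cor_3_8 :=
  M.toBelyiModel_cor_3_8_of_ker_le_of_isEmpty_cusp
    (fun _ _ O => NFOpen.ker_le_of_openImmersionKernelLaw M hK O) hE hne

end BelyiDatumModel

/-! ## A datum model SATISFYING the typed law where both datum facts FAIL -/

section Closure

variable {G : Type u} [Group G] [TopologicalSpace G] [IsTopologicalGroup G]

/-- A closed normal subgroup is its own closed normal closure. [cite: MochizukiAbsTopI2012, Def 4.2 (iii)(c) p.50] -/
private theorem topologicalClosure_normalClosure_eq_of_isClosed (N : Subgroup G) [N.Normal]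
    (hN : IsClosed (N : Set G)) : (Subgroup.normalClosure (N : Set G)).topologicalClosure = N := by
  rw [Subgroup.normalClosure_eq_self]
  exact le_antisymm (Subgroup.topologicalClosure_minimal _ le_rfl hN) (Subgroup.le_topologicalClosure _)

/-- In a `T1` group the closed normal closure of the empty set is trivial. [cite: MochizukiAbsTopI2012, Def 4.2 (iii)(c) p.50] -/
private theorem topologicalClosure_normalClosure_empty [T1Space G] :
    (Subgroup.normalClosure (∅ : Set G)).topologicalClosure = ⊥ := by
  rw [Subgroup.normalClosure_empty]
  refine le_antisymm (Subgroup.topologicalClosure_minimal _ le_rfl ?_) bot_le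
  rw [Subgroup.coe_bot]
  exact isClosed_singleton

end Closure

/-- **A junk datum model SATISFYING `OpenImmersionKernelLaw` in which both datum facts FAIL** (universe
`0`; the law-abiding separation model of `BelyiCuspidalizationDatumKernelLaw.lean` with abc-iut-L4-t6's
EXACT law — kernel `=` closed normal closure of `⋃_{c ∈ S} I_c` — baked into the datum's Hom-sets): over
`ℚ_2`, chain-full, rel-isom-DGC, flags = laws, members `X₁ ≅ X₂` cusp-free with `IsCor37Member`; the open
`ι : U → X₁` with `[π₁(ι)] = [pr₁ : (G × G) × G ↠ G × G]` records ONE cusp with `D = I = Ker(pr₁)`, so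
the law holds with `S = {that cusp}` while `pr₁` identifies points; `¬ toBelyiModel.Cor_3_7''` by the
kernel form at the cusp-free `X₁`, `¬ toBelyiModel.Cor_3_8` since every open of `X₂` is bijective.
[cite: MochizukiAbsTopII2013, Cor 3.7 pp.72-73] -/
theorem BelyiDatumModel.exists_openImmersionKernelLaw_and_not_toBelyiModel_cor_3_7''_and_not_cor_3_8 :
    ∃ (𝒟 : ConstructionDataClass.{0}) (M : BelyiDatumModel 𝒟),
      𝒟.IsChainFull ∧ 𝒟.RelIsomDGC ∧ M.toEllipticDatumModel.OpenImmersionKernelLaw ∧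
      (∀ (b : 𝒟.Base) (X : (𝒟.datum b).Obj), 𝒟.Mem b X → M.toBelyiModel.IsCor37Member b X) ∧
      (∀ (b : 𝒟.Base) (X : (𝒟.datum b).Obj), 𝒟.Mem b X → IsEmpty (M.cusps b X).Cusp) ∧
      ¬ M.toBelyiModel.Cor_3_7'' ∧ ¬ M.toBelyiModel.Cor_3_8 := by
  let Γ : ProfiniteGrp.{0} := absoluteGaloisGrp ℚ_[2]
  -- the members: `Π := G × G ↠ G` (second projection)
  let P : AugmentedProfiniteGrp Γ :=
    { arith := ProfiniteGrp.of (Γ × Γ), aug := ContinuousMonoidHom.snd Γ Γ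
      aug_surjective := fun g => ⟨(1, g), rfl⟩ }
  -- the open `U`: `Π_U := (G × G) × G ↠ G`
  let Q : AugmentedProfiniteGrp Γ :=
    { arith := ProfiniteGrp.of ((Γ × Γ) × Γ)
      aug := (ContinuousMonoidHom.snd Γ Γ).comp (ContinuousMonoidHom.fst (Γ × Γ) Γ)
      aug_surjective := fun g => ⟨((1, g), 1), rfl⟩ }
  -- `[π₁(U ↪ X₁)] = [pr₁]`
  let ι₀ : HomOver Q P := ⟨ContinuousMonoidHom.fst (Γ × Γ) Γ, fun _ => rfl⟩
  -- the ONE cusp recorded on `U`: `D = I = Ker(pr₁) = 1 × 1 × G ⊆ Δ_U`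
  let K₀ : Subgroup ((Γ × Γ) × Γ) := (MonoidHom.fst (Γ × Γ) Γ).ker
  have hK₀ : IsClosed (K₀ : Set ((Γ × Γ) × Γ)) := by
    rw [MonoidHom.coe_ker]
    exact isClosed_singleton.preimage continuous_fst
  have hK₀Δ : K₀ ⊓ Q.toExtension.geom = K₀ := by
    refine inf_eq_left.mpr fun x hx => ?_
    have hx1 : x.1 = 1 := hx
    change x.1.2 = 1
    rw [hx1]
    rfl
  have hι₀K : ι₀.toHom.toMonoidHom.ker = K₀ := rfl
  let grp : Option Bool → AugmentedProfiniteGrp Γ := fun o => o.elim Q fun _ => P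
  -- cusps: none on the members, one on `U`
  let C : ∀ o : Option Bool, CuspidalData (grp o).toExtension := fun o =>
    o.rec
      { Cusp := PUnit.{1}
        Dcusp := fun _ => K₀
        Icusp := fun _ => K₀ ⊓ Q.toExtension.geom
        Icusp_eq := fun _ => rfl
        isClosed_Dcusp := fun _ => hK₀
        eq_of_conj := fun _ _ _ _ => rfl }
      fun _ =>
        { Cusp := PEmpty.{1}
          Dcusp := fun x => x.elim
          Icusp := fun x => x.elim
          Icusp_eq := fun x => x.elim
          isClosed_Dcusp := fun x => x.elim
          eq_of_conj := fun x => x.elim }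
  -- abc-iut-L4-t6's kernel law, as a predicate on outer homomorphisms out of `A`
  let Law : ∀ A B : Option Bool, OuterHom (grp A) (grp B) → Prop := fun A B q =>
    ∀ ψ : HomOver (grp A) (grp B), OuterHom.mk ψ = q →
      ∃ S : Set (C A).Cusp,
        (ψ.toHom.toMonoidHom.ker : Subgroup (grp A).toExtension.arith) =
          (Subgroup.normalClosure (⋃ c ∈ S,
            ((C A).Icusp c : Set (grp A).toExtension.arith))).topologicalClosure
  have hLaw_iso : ∀ (A B : Option Bool) (q : OuterHom (grp A) (grp B)), q.IsIso → Law A B q := by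
    intro A B q hq ψ hψ
    rw [← hψ] at hq
    refine ⟨∅, ?_⟩
    rw [Set.biUnion_empty, topologicalClosure_normalClosure_empty]
    exact (MonoidHom.ker_eq_bot_iff _).mpr fun a b hab => ((OuterHom.isIso_mk ψ).mp hq).1 hab
  let D : RelativeAnabelianDatum Γ :=
    { Obj := Option Bool
      Hom := fun A B =>
        {q : OuterHom (grp A) (grp B) // ((A ≠ none ∨ B = some false) → q.IsIso) ∧ Law A B q}
      IsIso := fun f => f.1.IsIso
      IsHyperbolicCurve := fun _ => True
      primes := Set.univ
      grp := grp
      outerHom := fun f => f.1 }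
  let 𝒟 : ConstructionDataClass.{0} :=
    { Base := PUnit.{1}
      fld := fun _ => ℚ_[2]
      instField := fun _ => inferInstance
      instCharZero := fun _ => inferInstance
      datum := fun _ => D
      Mem := fun _ X => X ≠ none
      IsHyperbolicOrbicurve := fun _ _ => True
      isHyperbolicOrbicurve_of_isHyperbolicCurve := fun _ _ _ => trivial
      chainTerms := fun _ _ => ∅ }
  let M : BelyiDatumModel 𝒟 :=
    { cusps := fun _ o => C o
      IsFinEt := fun f => ∀ φ, OuterHom.mk φ = f.1 → Function.Injective φ.toHom ∧ φ.IsOpenHom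
      isFinEt_injective := fun _ h φ hφ => h φ hφ
      IsOpenImmersion := fun f => ∀ ψ, OuterHom.mk ψ = f.1 → Function.Surjective ψ.toHom
      isOpenImmersion_surjective := fun _ h ψ hψ => h ψ hψ
      IsOncePuncturedElliptic := fun _ _ => True
      IsEllipticallyAdmissible := fun _ _ => True
      IsStrictlyBelyiType := fun _ _ => True
      IsDefinedOverNF := fun _ _ => True }
  have hfull : 𝒟.IsChainFull := fun _ _ _ _ ht => ((Set.mem_empty_iff_false _).mp ht).elim
  have hGC : 𝒟.RelIsomDGC := fun _ A B _ _ =>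
    ⟨fun f hf => hf, fun f _ f' _ h => Subtype.ext h,
      fun c hc => ⟨⟨c, fun _ => hc, hLaw_iso A B c hc⟩, hc, rfl⟩⟩
  -- THE TYPED LAW HOLDS: it is the second clause of every Hom-set
  have hlaw : M.toEllipticDatumModel.OpenImmersionKernelLaw := ⟨fun ι _ ψ hψ => ι.2.2 ψ hψ⟩
  have hk : IsGeneralizedSubpadicFor ℚ_[2] 2 := (IsSubpadicFor.padic 2).isGeneralizedSubpadicFor
  have hΓ : IsSlimGroup Γ :=
    isSlimGroup_of_iso_absoluteGaloisGrp_of_isGeneralizedSubpadicFor_holds hk (Iso.refl _)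
  -- `Δ = G × 1 ≅ G` is slim …
  let E₀ : FundamentalExtension.{0} := P.toExtension
  let e : Γ ≃ₜ* ↥E₀.geom :=
    { toFun := fun g => ⟨(g, 1), rfl⟩
      invFun := fun x => x.1.1
      left_inv := fun _ => rfl
      right_inv := fun x => by
        obtain ⟨⟨g, h⟩, hx⟩ := x
        have hh : h = 1 := hx
        subst hh
        rfl
      map_mul' := fun g h => Subtype.ext (Prod.ext rfl (one_mul (1 : Γ)).symm)
      continuous_toFun := Continuous.subtype_mk (continuous_id.prodMk continuous_const) _
      continuous_invFun := continuous_fst.comp continuous_subtype_val }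
  have hΔ : IsSlimGroup ↥E₀.geom := isSlimGroup_of_continuousMulEquiv e hΓ
  -- … and nontrivial
  haveI : Infinite (Field.absoluteGaloisGroup ℚ_[2]) := Padic.infinite_absoluteGaloisGroup 2
  obtain ⟨σ, hσ⟩ := exists_ne (1 : Field.absoluteGaloisGroup ℚ_[2])
  have hne : E₀.geom ≠ ⊥ := by
    intro h
    have hmem : ((σ, 1) : Γ × Γ) ∈ E₀.geom := rfl
    rw [h] at hmem
    exact hσ (Prod.mk_eq_one.mp (Subgroup.mem_bot.mp hmem)).1
  have hX : ∀ x : Bool, M.toBelyiModel.IsCor37Member PUnit.unit (some x) := fun x =>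
    M.toBelyiModel.isCor37Member_of_isGeneralizedSubpadicFor (Option.some_ne_none x) rfl trivial
      hk hΔ hne
  -- the datum open immersion `ι : U → X₁` OBEYS the typed law with `S = {the cusp}`:
  -- `Ker(g · pr₁ · g⁻¹) = Ker(pr₁) = I = D`, closed and normal
  haveI hK₀n : K₀.Normal := MonoidHom.normal_ker _
  have hιlaw : Law none (some true) (OuterHom.mk ι₀) := by
    intro ψ hψ
    refine ⟨Set.univ, ?_⟩
    rw [HomOver.ker_eq_of_mk_eq_mk hψ]
    change ι₀.toHom.toMonoidHom.ker =
      (Subgroup.normalClosure (⋃ c ∈ (Set.univ : Set PUnit.{1}),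
        ((K₀ ⊓ Q.toExtension.geom : Subgroup ((Γ × Γ) × Γ)) : Set ((Γ × Γ) × Γ)))).topologicalClosure
    rw [Set.biUnion_univ, Set.iUnion_const, hK₀Δ,
      topologicalClosure_normalClosure_eq_of_isClosed K₀ hK₀, hι₀K]
  have hι : ((none : Option Bool) ≠ none ∨ some true = some false) →
      (OuterHom.mk ι₀ : OuterHom Q P).IsIso := fun h =>
    h.elim (fun h => (h rfl).elim) fun h => absurd h (by decide)
  let ι : D.Hom none (some true) := ⟨OuterHom.mk ι₀, hι, hιlaw⟩
  have hι₀ : Function.Surjective ι₀.toHom := fun g => ⟨(g, 1), rfl⟩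
  let O₁ : M.NFOpen PUnit.unit (some true) :=
    { U := none
      ι := ι
      isOpenImmersion := fun ψ hψ => HomOver.surjective_of_mk_eq_mk hψ hι₀
      definedOverNF := trivial
      ψ := ι₀
      mk_ψ := rfl }
  -- `pr₁` kills the nontrivial element `((1, 1), σ)`
  have hninj : ¬ Function.Injective O₁.ψ.toHom := by
    intro hinj
    have h1 : O₁.ψ.toHom (((1, 1), σ) : (Γ × Γ) × Γ) = O₁.ψ.toHom 1 := rfl
    exact hσ (Prod.mk_eq_one.mp (hinj h1)).2
  -- every datum morphism INTO `X₂` induces an outer isomorphism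
  have hX₂ : ∀ O₂ : M.NFOpen PUnit.unit (some false), Function.Bijective O₂.ψ.toHom := fun O₂ => by
    have h : (OuterHom.mk O₂.ψ).IsIso := by
      rw [O₂.mk_ψ]
      exact O₂.ι.2.1 (Or.inr rfl)
    exact (OuterHom.isIso_mk O₂.ψ).mp h
  refine ⟨𝒟, M, hfull, hGC, hlaw, ?_, ?_, ?_, ?_⟩
  · intro _ X hXmem
    obtain ⟨x, rfl⟩ := Option.ne_none_iff_exists'.mp hXmem
    exact hX x
  · intro _ X hXmem
    obtain ⟨x, rfl⟩ := Option.ne_none_iff_exists'.mp hXmem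
    exact inferInstanceAs (IsEmpty PEmpty.{1})
  · exact M.toBelyiModel.not_cor_3_7''_of_isEmpty_cusp hfull hGC (hX true)
      (inferInstanceAs (IsEmpty PEmpty.{1})) O₁ hninj
  · intro h38
    have hcyc : IsOpen (Set.range (cyclotomicChar ℚ_[2] 2)) := hk.isOpen_range_cyclotomicChar
    obtain ⟨O₂, ⟨φU, hφU⟩, -⟩ := h38 hfull hGC PUnit.unit PUnit.unit (some true) (some false)
      (hX true) (hX false) ⟨2, inferInstance, hcyc, hcyc⟩ (ContinuousMulEquiv.refl _) (by
        ext x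
        simp only [Subgroup.mem_map]
        constructor
        · rintro ⟨y, hy, rfl⟩
          exact hy
        · exact fun hx => ⟨x, hx, rfl⟩) O₁
    have key : ∀ x, O₂.ψ.toHom (φU x) = O₁.ψ.toHom x := fun x => hφU x
    refine hninj fun x y hxy => φU.injective ((hX₂ O₂).1 ?_)
    rw [key, key, hxy]

/-! ## The typed law does NOT close the rows -/

/-- **The typed kernel law does not close the datum Cor 3.7**: over datum models SATISFYING
`OpenImmersionKernelLaw` (with `𝒟` chain-full, rel-isom-DGC, every member satisfying the standing
hypotheses) `toBelyiModel.Cor_3_7''` still fails somewhere — it remains a HYPOTHESIS ON `(𝒟, M)`,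
bindable per instance; the law decides it only at cusp-free data
(`toBelyiModel_cor_3_7''_of_openImmersionKernelLaw_of_isEmpty_cusp`). [cite: MochizukiAbsTopII2013, Cor 3.7 pp.72-73] -/
theorem BelyiDatumModel.not_forall_toBelyiModel_cor_3_7''_of_openImmersionKernelLaw :
    ¬ ∀ (𝒟 : ConstructionDataClass.{0}) (M : BelyiDatumModel 𝒟),
      𝒟.IsChainFull → 𝒟.RelIsomDGC → M.toEllipticDatumModel.OpenImmersionKernelLaw →
      (∀ (b : 𝒟.Base) (X : (𝒟.datum b).Obj), 𝒟.Mem b X → M.toBelyiModel.IsCor37Member b X) →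
        M.toBelyiModel.Cor_3_7'' := by
  intro H
  obtain ⟨𝒟, M, hfull, hGC, hlaw, hmem, -, h37, -⟩ :=
    BelyiDatumModel.exists_openImmersionKernelLaw_and_not_toBelyiModel_cor_3_7''_and_not_cor_3_8
  exact h37 (H 𝒟 M hfull hGC hlaw hmem)

/-- **… nor the datum Cor 3.8.** [cite: MochizukiAbsTopII2013, Cor 3.8 p.74] -/
theorem BelyiDatumModel.not_forall_toBelyiModel_cor_3_8_of_openImmersionKernelLaw :
    ¬ ∀ (𝒟 : ConstructionDataClass.{0}) (M : BelyiDatumModel 𝒟),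
      𝒟.IsChainFull → 𝒟.RelIsomDGC → M.toEllipticDatumModel.OpenImmersionKernelLaw →
      (∀ (b : 𝒟.Base) (X : (𝒟.datum b).Obj), 𝒟.Mem b X → M.toBelyiModel.IsCor37Member b X) →
        M.toBelyiModel.Cor_3_8 := by
  intro H
  obtain ⟨𝒟, M, hfull, hGC, hlaw, hmem, -, -, h38⟩ :=
    BelyiDatumModel.exists_openImmersionKernelLaw_and_not_toBelyiModel_cor_3_7''_and_not_cor_3_8
  exact h38 (H 𝒟 M hfull hGC hlaw hmem)

end Literature.AnabelianGeometry.AbsoluteAnabelian.AbsTopII
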